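import Summits.HubbardSuperconductivity.HubbardSuperconductivity.Theorems.AnisotropyChordTransferFibre3KTAssemblySmallDelta
import Summits.HubbardSuperconductivity.HubbardSuperconductivity.Theorems.AnisotropyChordTransferFibre3L2Targets

/-!
# Route `AnisotropyChord` / H0 rotor rung: LEMMA κ₀ (the algebraic half of L2) PROVED, and the GM₃ assembly modulo THEOREM G2

Theory seat `hubbard-h0-rotor-theory-1`, REPORT 24 / PartN34 (`…Fibre3L2Targets`), memo 19 §250: with the second-gap hypothesis
`SecondGapK1 m₀` (the isotropic `K₁` fibre has `H₀ − W ≥ ε₁ + m₀` on hard-core functions orthogonal to the pole waves) and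
`m := m₀ − T ≥ 0`, `T < 2ε₁`, `Δ ∈ (0,1]`, every shell vector `y` satisfies

  `Re⟨y, Q̃(T) y⟩ ≥ Σ_s |y_s|² (ηW_s + m)/(ΔW_s(W_s + m)) ≥ ((3η + m)/(3 + m))·Σ_s |y_s|²/(ΔW_s)`,  `η = 1 − Δ`

(**`kappaZeroPointwise_holds`**, **`kappaZeroAlgebra_holds`**, `L ≥ 4`).  Proof as in the theory file: `Y := G_T ẑ = G^{hc} y`
(`…Fibre3ShellCoercive`: vanishes on `D`, `⟂` poles, `Re⟨y, R y⟩ = Re⟨y, Y|_S⟩ = Re⟨Y,(H₀−E)Y⟩`), the second gap gives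
`Re⟨Y,(H₀−E)Y⟩ ≥ Σ_S (W_s + m)|Y_s|²`, and `2Re(ȳY) − α|Y|² ≤ |y|²/α` pointwise.  Consequences:
**`l2FromSecondGap_holds : L2FromSecondGap L Δ`**, **`l2QuantG_of_secondGap`** (`SecondGapK1 (ε₁cos²θ/2) → L2QuantG L Δ`), and
**`gm3_of_cruxes_secondGap`**: the §301 assembly with `L2Quant` replaced by the NAMED spectral hypothesis
`SecondGapK1 L (ε₁·cos²θ/2)` (THEOREM G2) — everything else kernel-checked.
Prover seat `hubbard-h0-rotor-p1` g22; helper for stmt-HubbardSuperconductivity-19089 (`--supports`).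
-/

set_option linter.dupNamespace false
set_option autoImplicit false

noncomputable section

open scoped BigOperators
open Complex Matrix

namespace Summit.HubbardSuperconductivity.HubbardSuperconductivity.Theorems.AnisotropyChord.Transfer.Fibre3

variable (L : ℕ) [NeZero L]

/-! ## The two expressions of `Re⟨y, R(T) y⟩` -/

/-- `Re⟨y, R(T) y⟩ = Re⟨y, Y|_S⟩`, `Y = G_T ẑ`. [folklore] -/
theorem re_Rmat_eq_shell (hL : 4 ≤ L) {T : ℝ} (hT : T < 2 * eps1 L) (y : Ssub L → ℂ) :
    (star y ⬝ᵥ Rmat L T *ᵥ y).re = (star y ⬝ᵥ (fun s : Ssub L => Gapply L T (zhat L T y) s.1)).re := by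
  rw [Rmat_form_eq L hL hT, ip_zhat_eq L hL hT]

/-- `Re⟨y, R(T) y⟩ = Re⟨Y, H₀Y⟩ − (ε₁ + T)·Re⟨Y, Y⟩`, `Y = G_T ẑ`. [folklore] -/
theorem re_Rmat_eq_energy (hL : 4 ≤ L) {T : ℝ} (hT : T < 2 * eps1 L) (y : Ssub L → ℂ) :
    (star y ⬝ᵥ Rmat L T *ᵥ y).re
      = (ip L (Gapply L T (zhat L T y)) (H0apply L (K1 L) (Gapply L T (zhat L T y)))).re
        - (eps1 L + T) * (ip L (Gapply L T (zhat L T y)) (Gapply L T (zhat L T y))).re := by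
  have hL2 : 2 ≤ L := by omega
  set Y := Gapply L T (zhat L T y) with hY
  have horth : ∀ j : Fin 3, ip L (poleWave L j) Y = 0 := fun j => ip_poleWave_Gapply L T _ j
  have e1 : ip L Y (fun c => H0apply L (K1 L) Y c - ((eps1 L + T : ℝ) : ℂ) * Y c) = ip L Y (zhat L T y) := by
    have hpt : (fun c => H0apply L (K1 L) Y c - ((eps1 L + T : ℝ) : ℂ) * Y c)
        = fun c => zhat L T y c - PiPole L (zhat L T y) c := by
      funext c; rw [hY, H0E_Gapply L hL hT]
    rw [hpt, ip_sub_right, ip_PiPole_of_orth L hL2 horth, sub_zero]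
  have e2 : (ip L Y (zhat L T y)).re = (ip L (zhat L T y) Y).re := by
    rw [← conj_ip, Complex.conj_re]
  rw [Rmat_form_eq L hL hT, ← hY, ← e2, ← e1, ip_sub_right, Complex.sub_re]
  congr 1
  have : ip L Y (fun c => ((eps1 L + T : ℝ) : ℂ) * Y c) = ((eps1 L + T : ℝ) : ℂ) * ip L Y Y := by
    unfold ip; rw [Finset.mul_sum]; refine Finset.sum_congr rfl fun c _ => ?_; ring
  rw [this, Complex.re_ofReal_mul]

omit [NeZero L] in
/-- at most three nearest-neighbour pairs among three particles. [folklore] -/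
theorem Wcount_le_three (c : Cfg L) : Wcount L c ≤ 3 := by
  unfold Wcount; split_ifs <;> omega

/-- pointwise: `2Re(conj(y)·Y) − α|Y|² ≤ |y|²/α` for `α > 0`. [folklore] -/
theorem two_re_sub_le (y Y : ℂ) {α : ℝ} (hα : 0 < α) :
    2 * ((starRingEnd ℂ) y * Y).re - α * ‖Y‖ ^ 2 ≤ ‖y‖ ^ 2 / α := by
  have h1 : ((starRingEnd ℂ) y * Y).re ≤ ‖y‖ * ‖Y‖ := by
    refine le_trans (Complex.re_le_norm _) ?_
    rw [norm_mul, Complex.norm_conj]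
  have h2 : 2 * (‖y‖ * ‖Y‖) ≤ ‖y‖ ^ 2 / α + α * ‖Y‖ ^ 2 := by
    have key : 0 ≤ (‖y‖ / α - ‖Y‖) ^ 2 * α := by positivity
    have e : (‖y‖ / α - ‖Y‖) ^ 2 * α = ‖y‖ ^ 2 / α - 2 * (‖y‖ * ‖Y‖) + α * ‖Y‖ ^ 2 := by
      field_simp
      ring
    linarith [key, e]
  linarith

/-! ## LEMMA κ₀ -/

/-- **LEMMA κ₀, pointwise form** (`L ≥ 4`): `KappaZeroPointwise L`. [folklore] -/
theorem kappaZeroPointwise_holds (hL : 4 ≤ L) : KappaZeroPointwise L := by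
  intro T m0 Δ hT hTm hΔ0 hΔ1 hSG y
  set Y := Gapply L T (zhat L T y) with hY
  have hY0 : ∀ c, InD L c = true → Y c = 0 := fun c hc => Gapply_zhat_D L hL hT y c hc
  have horth : ∀ j : Fin 3, ip L (poleWave L j) Y = 0 := fun j => ip_poleWave_Gapply L T _ j
  set q : ℝ := (star y ⬝ᵥ Rmat L T *ᵥ y).re with hq
  set m : ℝ := m0 - T with hm
  have hm0 : 0 ≤ m := by rw [hm]; linarith
  -- the second gap on Y
  have hgap := hSG Y hY0 horth
  rw [re_ip_Happly] at hgap
  -- q = Re⟨Y,(H₀−E)Y⟩ ≥ Σ_S (W_s + m)|Y_s|²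
  have hq2 := re_Rmat_eq_energy L hL hT y
  rw [← hY, ← hq] at hq2
  have hYY : (ip L Y Y).re = ∑ c : Cfg L, ‖Y c‖ ^ 2 := ip_self_re L Y
  have hlow : ∑ s : Ssub L, ((Wcount L s.1 : ℝ) + m) * ‖Y s.1‖ ^ 2 ≤ q := by
    have h1 := sum_Ssub_le L (fun c => ((Wcount L c : ℝ) + m) * ‖Y c‖ ^ 2) (fun c => by positivity)
    have h2 : ∑ c : Cfg L, ((Wcount L c : ℝ) + m) * ‖Y c‖ ^ 2
        = ∑ c : Cfg L, (Wcount L c : ℝ) * ‖Y c‖ ^ 2 + m * ∑ c : Cfg L, ‖Y c‖ ^ 2 := by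
      rw [Finset.mul_sum, ← Finset.sum_add_distrib]
      refine Finset.sum_congr rfl fun c _ => ?_; ring
    rw [h2, ← hYY] at h1
    have : ∑ c : Cfg L, (Wcount L c : ℝ) * ‖Y c‖ ^ 2 + m * (ip L Y Y).re ≤ q := by
      rw [hq2, hm]; nlinarith [hgap, ip_self_nonneg L Y]
    exact le_trans h1 this
  -- q = Re Σ_s conj(y_s) Y_s
  have hq1 : q = ∑ s : Ssub L, ((starRingEnd ℂ) (y s) * Y s.1).re := by
    rw [hq, re_Rmat_eq_shell L hL hT, ← hY]
    simp only [dotProduct, Pi.star_apply, Complex.star_def, Complex.re_sum]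
  -- q ≤ Σ |y_s|²/(W_s + m)
  have hW : ∀ s : Ssub L, (0 : ℝ) < Wcount L s.1 := fun s => by exact_mod_cast Wcount_pos_of_InS L s.2
  have hqle : q ≤ ∑ s : Ssub L, ‖y s‖ ^ 2 / ((Wcount L s.1 : ℝ) + m) := by
    have hpt : ∀ s : Ssub L, 2 * ((starRingEnd ℂ) (y s) * Y s.1).re - ((Wcount L s.1 : ℝ) + m) * ‖Y s.1‖ ^ 2
        ≤ ‖y s‖ ^ 2 / ((Wcount L s.1 : ℝ) + m) :=
      fun s => two_re_sub_le (y s) (Y s.1) (by have := hW s; linarith)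
    have hsum := Finset.sum_le_sum fun s (_ : s ∈ Finset.univ) => hpt s
    rw [Finset.sum_sub_distrib, ← Finset.mul_sum, ← hq1] at hsum
    linarith
  -- Re⟨y, Q̃ y⟩ = Σ|y|²/(ΔW) − q
  rw [Qtilde_eq, Matrix.sub_mulVec, dotProduct_sub, Complex.sub_re, re_diagW_form, ← hq]
  have key : ∑ s : Ssub L, ‖y s‖ ^ 2 * (((1 - Δ) * (Wcount L s.1 : ℝ) + (m0 - T)) /
        (Δ * (Wcount L s.1 : ℝ) * ((Wcount L s.1 : ℝ) + (m0 - T))))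
      = ∑ s : Ssub L, ‖y s‖ ^ 2 / (Δ * (Wcount L s.1 : ℝ)) - ∑ s : Ssub L, ‖y s‖ ^ 2 / ((Wcount L s.1 : ℝ) + m) := by
    rw [← Finset.sum_sub_distrib]
    refine Finset.sum_congr rfl fun s _ => ?_
    have h1 : (Wcount L s.1 : ℝ) ≠ 0 := (hW s).ne'
    have h2 : (Wcount L s.1 : ℝ) + m ≠ 0 := by have := hW s; linarith
    rw [← hm]
    field_simp
    ring
  rw [key]
  linarith

/-- **LEMMA κ₀, algebraic half** (`L ≥ 4`): `KappaZeroAlgebra L`. [folklore] -/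
theorem kappaZeroAlgebra_holds (hL : 4 ≤ L) : KappaZeroAlgebra L := by
  intro T m0 Δ hT hTm hΔ0 hΔ1 hSG y
  refine le_trans ?_ (kappaZeroPointwise_holds L hL T m0 Δ hT hTm hΔ0 hΔ1 hSG y)
  rw [Finset.mul_sum]
  apply Finset.sum_le_sum
  intro s _
  have hW : (1 : ℝ) ≤ Wcount L s.1 := by exact_mod_cast Wcount_pos_of_InS L s.2
  have hW3 : (Wcount L s.1 : ℝ) ≤ 3 := by exact_mod_cast Wcount_le_three L s.1
  have hm : 0 ≤ m0 - T := by linarith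
  set W : ℝ := (Wcount L s.1 : ℝ) with hWdef
  set m : ℝ := m0 - T with hmdef
  -- (3η+m)/(3+m) ≤ (ηW+m)/(W+m) for 1 ≤ W ≤ 3, η ≤ 1, m ≥ 0
  have hmono : (3 * (1 - Δ) + m) / (3 + m) ≤ ((1 - Δ) * W + m) / (W + m) := by
    rw [div_le_div_iff₀ (by linarith) (by linarith)]
    nlinarith [mul_nonneg hm (mul_nonneg (by linarith : (0 : ℝ) ≤ 3 - W) hΔ0.le)]
  have e : ‖y s‖ ^ 2 * (((1 - Δ) * W + m) / (Δ * W * (W + m))) = ((1 - Δ) * W + m) / (W + m) * (‖y s‖ ^ 2 / (Δ * W)) := by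
    have h1 : W ≠ 0 := by linarith
    have h2 : W + m ≠ 0 := by linarith
    field_simp
  rw [e]
  exact mul_le_mul_of_nonneg_right hmono (by positivity)

/-! ## L2 from the second gap, and the assembly modulo THEOREM G2 -/

/-- **`L2FromSecondGap L Δ` holds** (the algebraic half is a hypothesis of the Prop). [folklore] -/
theorem l2FromSecondGap_holds (Δ : ℝ) : L2FromSecondGap L Δ := by
  intro hΔ0 hΔ1 hKZ hSG lam2 f hf hT2 hm y
  have hm' : Tplus L Δ f ≤ eps1 L * cos2theta L / 2 := by rw [mHole_eq] at hm; linarith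
  have h := hKZ (Tplus L Δ f) (eps1 L * cos2theta L / 2) Δ hT2 hm' hΔ0 hΔ1 hSG y
  have e : g0hat L Δ f = (3 * (1 - Δ) + (eps1 L * cos2theta L / 2 - Tplus L Δ f)) / (3 + (eps1 L * cos2theta L / 2 - Tplus L Δ f)) := by
    unfold g0hat; rw [mHole_eq]
  rw [e]; exact h

/-- **`L2QuantG` from THEOREM G2** (`L ≥ 4`, `0 < Δ ≤ 1`). [folklore] -/
theorem l2QuantG_of_secondGap (hL : 4 ≤ L) {Δ : ℝ} (hΔ0 : 0 < Δ) (hΔ1 : Δ ≤ 1)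
    (hSG : SecondGapK1 L (eps1 L * cos2theta L / 2)) : L2QuantG L Δ :=
  l2FromSecondGap_holds L Δ hΔ0 hΔ1 (kappaZeroAlgebra_holds L hL) hSG

/-- **THE GM₃ ASSEMBLY MODULO THEOREM G2:** as `KTAssemblyAbs` (memo 21 §301), with the shell-coercivity hypothesis `L2Quant`
replaced by the named spectral hypothesis `SecondGapK1 L (ε₁·cos²θ/2)`; `0 ≤ mHole` suffices. [folklore] -/
theorem gm3_of_cruxes_secondGap (hL4 : 4 ≤ L) {Δ : ℝ} (hΔ0 : 0 < Δ) (hΔ1 : Δ < 1) (c a b : ℝ) {ρ : ℝ} (hρ : 0 < ρ)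
    (hSG : SecondGapK1 L (eps1 L * cos2theta L / 2))
    {lam2 : ℝ} {f : Tor L → ℝ} (hf : IsGroundTwoMagnon L Δ lam2 f) (hT2 : Tplus L Δ f < 2 * eps1 L)
    (hm : 0 ≤ mHole L Δ f) (hside : facMI L Δ f * etaEff L lam2 * (a + b / ρ) < c)
    (hKT1 : TrialGapAbs L Δ c) (hKT2a : LowShellGFormAbs L Δ a) (hKT2b : OffPoleTailAbs L Δ b)
    (hden : DenMinRest L Δ ρ) : GM3Fibre L Δ := by
  have hL2G := l2QuantG_of_secondGap L hL4 hΔ0 hΔ1.le hSG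
  have hĝ : 0 < g0hat L Δ f := by
    unfold g0hat
    apply div_pos <;> nlinarith
  have hcoer : ∀ y : Ssub L → ℂ, g0hat L Δ f * ∑ s : Ssub L, ‖y s‖ ^ 2 / (Δ * (Wcount L s.1 : ℝ))
      ≤ (star y ⬝ᵥ Qtilde L (Tplus L Δ f) Δ *ᵥ y).re := fun y => hL2G lam2 f hf hT2 hm y
  exact gm3_of_cruxes_coercive L hL4 hΔ0 hΔ1 c a b hρ hĝ hf hT2 hcoer hside hKT1 hKT2a hKT2b hden

end Summit.HubbardSuperconductivity.HubbardSuperconductivity.Theorems.AnisotropyChord.Transfer.Fibre3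

end
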